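import Mathlib
import HarnessLib
import Summits.QuantumFields.YangMills.Theses.U1DipoleHelicity
import Summits.QuantumFields.YangMills.Theorems.U1DipoleHelicityFreeDipoleBoxMeanHalf

/-!
# U1DipoleHelicity — the route `Assembly` (item stmt-QuantumFields-25884)

Route `U1DipoleHelicity` (abelian COMPARISON line onto the node `Theorems.U1HelicityGapD4`, whose tree
corollary is Wilson-action `U(1)₄` masslessness `AbelianMasslessPhaseD4`; NOT a rung of `YangMills`).
Its assembly item is the implication

`WilsonU1DipoleLawD4 → WilsonU1PlaquetteSecondMomentD4 → FreeDipoleBoxMeanHalf → U1MeanPlaqToOneD4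
  → U1HelicityGapD4`,

proved here (`assembly_proof`) with the explicit stiffness `δ = 1/5` at the budget `ε = 1/40`:

* `boxSecondMoment_eq` — the FINITE-SUPPORT second-moment identity
  `∫ (Σ_{x∈B_N} sin θ_{(x;0,1)})² dμ = Σ_{x,y∈B_N} G_μ(y−x;0,1)` for every limit state (translation
  invariance `U1Helicity.integral_u1PlaqIm_mul`; no summability of `G`, unlike `U1Helicity.boxVar_eq`);
* `boxSecondMoment_le` — inserting the dipole law `G = K/β' + R`, `βΣ_z|R(z)| ≤ ε`:
  `β·∫(Σ_{B_N} sin θ)² ≤ (β/β')·Σ_{x,y∈B_N}K(x−y) + ε·#B_N` (the remainder rows are bounded by the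
  full `ℓ¹` norm of `R`; the `K`-rows are re-indexed `(x,y) ↦ (y,x)`, so no parity of `K` is needed);
* `charge_ratio_le` — charge identification through `K(0) = 1/2` (`freeDipole_zero`, read off the
  landed swap identity `freeDipoleKernel_add_swap` at `z = 0`): `β|G(0) − K(0)/β'| ≤ ε` and
  `|2βG(0) − 1| ≤ ε` give `β/β' ≤ 1 + 3ε`;
* `u1HelicityGapD4_of_parts` — the mechanism for an ARBITRARY kernel `K` with `K(0) = 1/2`:
  with the box-mean law `Σ_{x,y}K(x−y)/#B_N → 1/2` and `⟨cos θ_p⟩ ≥ 1 − ε`,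
  `β·∫(Σ sin θ)²  ≤ ((1+3ε)(1/2+ε) + ε)·#B_N = (943/1600)·#B_N ≤ (⟨cos θ_p⟩ − 1/5)·#B_N` eventually in `N`.

Only the route's implication is proved; the node `U1HelicityGapD4` stays conditional on the open
cruxes `WilsonU1DipoleLawD4` (XL) and `WilsonU1PlaquetteSecondMomentD4`. Nothing here bears on the
Yang–Mills mass gap.
-/

noncomputable section

open MeasureTheory Filter Topology Finset
open Literature.Probability.LatticeModels

namespace Summit.QuantumFields.YangMills.Theorems.U1DipoleHelicity

/-- **`K(0) = 1/2`** for the free dipole kernel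
`K(z) = (2π)⁻⁴∫_{[-π,π]⁴} cos(k·z)(k̂₀²+k̂₁²)/Σ_μ k̂_μ² dk`: the swap identity
`K(z) + K(z₂,z₃,z₀,z₁) = [z = 0]` (`freeDipoleKernel_add_swap`) at `z = 0` reads `2K(0) = 1`. -/
theorem freeDipole_zero :
    (1 / (2 * Real.pi) ^ 4) * ∫ k in Set.pi Set.univ (fun _ : Fin 4 => Set.Icc (-Real.pi) Real.pi),
        Real.cos (∑ i : Fin 4, k i * ((0 : Site 4) i : ℝ)) *
          (((2 * Real.sin (k 0 / 2)) ^ 2 + (2 * Real.sin (k 1 / 2)) ^ 2) /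
            (∑ i : Fin 4, (2 * Real.sin (k i / 2)) ^ 2))
      = 1 / 2 := by
  have h := freeDipoleKernel_add_swap 0
  have h0 : (![(0 : Site 4) 2, (0 : Site 4) 3, (0 : Site 4) 0, (0 : Site 4) 1] : Site 4) = 0 := by
    funext i
    fin_cases i <;> simp
  rw [h0, if_pos rfl] at h
  linarith

/-! ### Assembly of the route `U1DipoleHelicity` (item stmt-QuantumFields-25884) -/

section Assembly

open Literature.MathematicalPhysics.QuantumLattice
open Literature.MathematicalPhysics.QuantumFieldTheory hiding IsLocalObservable Site ZdEdge
open Summit.QuantumFields.YangMills.Theorems.U1Helicity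

variable {β : ℝ} {μ : Measure (LGConfig 4 Circle)}

/-- **Finite-support second-moment identity.** For a limit state `μ` of Wilson `U(1)₄`,
`∫ (Σ_{x∈B_N} sin θ_{(x;0,1)})² dμ = Σ_{x,y∈B_N} G_μ(y − x; 0, 1)` (expand the square; translation
invariance `integral_u1PlaqIm_mul`). Unlike `U1Helicity.boxVar_eq` no summability of `G` is assumed. -/
theorem boxSecondMoment_eq (hμ : μ ∈ infiniteVolumeLimitPoints (d := 4) u1Rep β) (N : ℕ) :
    ∫ U, (∑ x ∈ box 4 N, u1PlaqIm x 0 1 U) ^ 2 ∂μ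
      = ∑ x ∈ box 4 N, ∑ y ∈ box 4 N, plaqCorr μ (y - x) 0 1 := by
  have hprob : IsProbabilityMeasure μ := by obtain ⟨_, _, h, _⟩ := hμ; exact h
  have hint : ∀ x y : Site 4,
      Integrable (fun U => u1PlaqIm x 0 1 U * u1PlaqIm y 0 1 U) μ := fun x y =>
    integrable_of_continuous ((continuous_u1PlaqIm _ _ _).mul (continuous_u1PlaqIm _ _ _))
      (C := 1) fun U => by
        rw [abs_mul]
        exact mul_le_one₀ (abs_u1PlaqIm_le _ _ _ _) (abs_nonneg _) (abs_u1PlaqIm_le _ _ _ _)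
  simp only [sq, Finset.sum_mul_sum]
  rw [integral_finsetSum _ (fun x _ => integrable_finsetSum _ fun y _ => hint x y)]
  refine Finset.sum_congr rfl fun x _ => ?_
  rw [integral_finsetSum _ (fun y _ => hint x y)]
  exact Finset.sum_congr rfl fun y _ => integral_u1PlaqIm_mul hμ x y 0 1

/-- A shifted box sum of a nonnegative summable function is at most the full sum. -/
theorem sum_box_shift_le_tsum {f : Site 4 → ℝ} (hf : Summable f) (hnn : ∀ z, 0 ≤ f z)
    (x : Site 4) (N : ℕ) : ∑ y ∈ box 4 N, f (y - x) ≤ ∑' z, f z := by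
  rw [← Finset.sum_image (f := f) (s := box 4 N) (g := fun y => y - x)
    (fun y _ y' _ h => sub_left_injective h)]
  exact hf.sum_le_tsum _ (fun z _ => hnn z)

/-- **Dipole decomposition of the box second moment.** If `G_μ(·;0,1) = K/β' + R` with
`β Σ_z |R(z)| ≤ ε` and `β ≥ 0`, then for every box
`β ∫ (Σ_{B_N} sin θ)² dμ ≤ (β/β') Σ_{x,y∈B_N} K(x−y) + ε #B_N`. -/
theorem boxSecondMoment_le (hμ : μ ∈ infiniteVolumeLimitPoints (d := 4) u1Rep β) (hβ : 0 ≤ β)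
    (K : Site 4 → ℝ) {β' ε : ℝ}
    (hs : Summable fun z : Site 4 => |plaqCorr μ z 0 1 - K z / β'|)
    (hR : β * ∑' z : Site 4, |plaqCorr μ z 0 1 - K z / β'| ≤ ε) (N : ℕ) :
    β * ∫ U, (∑ x ∈ box 4 N, u1PlaqIm x 0 1 U) ^ 2 ∂μ
      ≤ β / β' * ∑ x ∈ box 4 N, ∑ y ∈ box 4 N, K (x - y) + ε * #(box 4 N) := by
  rw [boxSecondMoment_eq hμ N]
  have hG : ∀ z, plaqCorr μ z 0 1 = K z / β' + (plaqCorr μ z 0 1 - K z / β') := fun z => by ring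
  have hSR : ∑ x ∈ box 4 N, ∑ y ∈ box 4 N, (plaqCorr μ (y - x) 0 1 - K (y - x) / β')
      ≤ #(box 4 N) * ∑' z, |plaqCorr μ z 0 1 - K z / β'| := by
    calc ∑ x ∈ box 4 N, ∑ y ∈ box 4 N, (plaqCorr μ (y - x) 0 1 - K (y - x) / β')
        ≤ ∑ x ∈ box 4 N, ∑ y ∈ box 4 N, |plaqCorr μ (y - x) 0 1 - K (y - x) / β'| :=
          Finset.sum_le_sum fun x _ => Finset.sum_le_sum fun y _ => le_abs_self _
      _ ≤ ∑ x ∈ box 4 N, ∑' z, |plaqCorr μ z 0 1 - K z / β'| :=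
          Finset.sum_le_sum fun x _ =>
            sum_box_shift_le_tsum (f := fun z => |plaqCorr μ z 0 1 - K z / β'|) hs
              (fun z => abs_nonneg _) x N
      _ = #(box 4 N) * ∑' z, |plaqCorr μ z 0 1 - K z / β'| := by
          rw [Finset.sum_const, nsmul_eq_mul]
  have hK : ∑ x ∈ box 4 N, ∑ y ∈ box 4 N, K (y - x) / β'
      = (1 / β') * ∑ x ∈ box 4 N, ∑ y ∈ box 4 N, K (x - y) := by
    rw [Finset.sum_comm, Finset.mul_sum]
    refine Finset.sum_congr rfl fun y _ => ?_
    rw [Finset.mul_sum]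
    refine Finset.sum_congr rfl fun x _ => ?_
    ring
  have hB : (0 : ℝ) ≤ #(box 4 N) := Nat.cast_nonneg _
  calc β * ∑ x ∈ box 4 N, ∑ y ∈ box 4 N, plaqCorr μ (y - x) 0 1
      = β * (∑ x ∈ box 4 N, ∑ y ∈ box 4 N, K (y - x) / β'
          + ∑ x ∈ box 4 N, ∑ y ∈ box 4 N, (plaqCorr μ (y - x) 0 1 - K (y - x) / β')) := by
        congr 1
        rw [← Finset.sum_add_distrib]
        refine Finset.sum_congr rfl fun x _ => ?_
        rw [← Finset.sum_add_distrib]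
        exact Finset.sum_congr rfl fun y _ => hG (y - x)
    _ = β / β' * ∑ x ∈ box 4 N, ∑ y ∈ box 4 N, K (x - y)
          + β * ∑ x ∈ box 4 N, ∑ y ∈ box 4 N, (plaqCorr μ (y - x) 0 1 - K (y - x) / β') := by
        rw [hK]; ring
    _ ≤ β / β' * ∑ x ∈ box 4 N, ∑ y ∈ box 4 N, K (x - y)
          + β * (#(box 4 N) * ∑' z, |plaqCorr μ z 0 1 - K z / β'|) :=
        add_le_add le_rfl (mul_le_mul_of_nonneg_left hSR hβ)
    _ ≤ β / β' * ∑ x ∈ box 4 N, ∑ y ∈ box 4 N, K (x - y) + ε * #(box 4 N) := by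
        have h1 : β * (#(box 4 N) * ∑' z, |plaqCorr μ z 0 1 - K z / β'|)
            = #(box 4 N) * (β * ∑' z, |plaqCorr μ z 0 1 - K z / β'|) := by ring
        rw [h1]
        nlinarith [mul_le_mul_of_nonneg_left hR hB]

/-- **Charge identification.** From the dipole law at the origin, `β |G(0) − K(0)/β'| ≤ ε` with
`K(0) = 1/2`, and the second-moment law `|2βG(0) − 1| ≤ ε`, the renormalised coupling satisfies
`β/β' ≤ 1 + 3ε` (for `β ≥ 0`). -/
theorem charge_ratio_le {β β' ε g K0 : ℝ} (hβ : 0 ≤ β) (hK0 : K0 = 1 / 2)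
    (hterm : β * |g - K0 / β'| ≤ ε) (hsec : |2 * β * g - 1| ≤ ε) :
    β / β' ≤ 1 + 3 * ε := by
  subst hK0
  have h := mul_le_mul_of_nonneg_left (neg_le_abs (g - 1 / 2 / β')) hβ
  have h' : β * -(g - 1 / 2 / β') = β / β' / 2 - β * g := by ring
  have h2 := (abs_le.1 hsec).2
  nlinarith [h, h', hterm, h2]

/-- **The route's mechanism, for an arbitrary kernel `K` with `K(0) = 1/2`.** The dipole law
(`G = K/β' + R`, `βΣ|R| ≤ ε`), the plaquette second-moment law (`2βG(0) → 1`), the box-mean law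
(`Σ_{x,y∈B_N}K(x−y)/#B_N → 1/2`) and `⟨cos θ_p⟩ → 1` give the helicity-gap inequality of the node
`U1HelicityGapD4` with the explicit stiffness `δ = 1/5` (take `ε = 1/40`:
`β·(2nd moment)/#B_N ≤ (1+3ε)(1/2+ε) + ε < 1 − ε − 1/5`). -/
theorem u1HelicityGapD4_of_parts (K : Site 4 → ℝ) (hK0 : K 0 = 1 / 2)
    (hDip : ∀ ε : ℝ, 0 < ε → ∃ β₁ : ℝ, ∀ β : ℝ, β₁ < β →
      ∀ μ ∈ infiniteVolumeLimitPoints (d := 4) u1Rep β, ∃ β' : ℝ, 0 < β' ∧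
        Summable (fun z : Site 4 => |plaqCorr μ z 0 1 - K z / β'|) ∧
        β * ∑' z : Site 4, |plaqCorr μ z 0 1 - K z / β'| ≤ ε)
    (hSec : Summit.QuantumFields.YangMills.Theses.U1DipoleHelicity.WilsonU1PlaquetteSecondMomentD4)
    (hBox : Filter.Tendsto (fun N : ℕ => (∑ x ∈ box 4 N, ∑ y ∈ box 4 N, K (x - y)) /
      ((box 4 N).card : ℝ)) Filter.atTop (nhds (1 / 2 : ℝ)))
    (hMean : Summit.QuantumFields.YangMills.Theses.U1DipoleHelicity.U1MeanPlaqToOneD4) :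
    ∃ β₁ : ℝ, ∀ β : ℝ, β₁ < β → ∀ μ ∈ infiniteVolumeLimitPoints (d := 4) u1Rep β,
      ∃ N₀ : ℕ, ∀ N : ℕ, N₀ ≤ N →
        β * ∫ U, (∑ x ∈ box 4 N, u1PlaqIm x 0 1 U) ^ 2 ∂μ ≤ (meanPlaq μ - 1 / 5) * #(box 4 N) := by
  obtain ⟨β₁, h₁⟩ := hDip (1 / 40) (by norm_num)
  obtain ⟨β₂, h₂⟩ := hSec (1 / 40) (by norm_num)
  obtain ⟨β₃, h₃⟩ := hMean (1 / 40) (by norm_num)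
  have hev : ∀ᶠ N : ℕ in atTop, (∑ x ∈ box 4 N, ∑ y ∈ box 4 N, K (x - y)) / ((box 4 N).card : ℝ)
      ∈ Set.Icc (1 / 2 - 1 / 40 : ℝ) (1 / 2 + 1 / 40) :=
    hBox.eventually_mem (Icc_mem_nhds (by norm_num) (by norm_num))
  obtain ⟨N₀, hN₀⟩ := eventually_atTop.1 hev
  refine ⟨max (max β₁ β₂) (max β₃ 0), fun β hβ μ hμ => ?_⟩
  have hβ1 : β₁ < β := lt_of_le_of_lt (le_trans (le_max_left _ _) (le_max_left _ _)) hβ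
  have hβ2 : β₂ < β := lt_of_le_of_lt (le_trans (le_max_right _ _) (le_max_left _ _)) hβ
  have hβ3 : β₃ < β := lt_of_le_of_lt (le_trans (le_max_left _ _) (le_max_right _ _)) hβ
  have hβ0 : 0 ≤ β :=
    le_of_lt (lt_of_le_of_lt (le_trans (le_max_right _ _) (le_max_right _ _)) hβ)
  obtain ⟨β', hβ', hs, hR⟩ := h₁ β hβ1 μ hμ
  have hsec : |2 * β * plaqCorr μ 0 0 1 - 1| ≤ 1 / 40 := h₂ β hβ2 μ hμ
  have hmean : 1 - 1 / 40 ≤ meanPlaq μ := h₃ β hβ3 μ hμ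
  -- charge identification at the origin
  have hterm : β * |plaqCorr μ 0 0 1 - K 0 / β'| ≤ 1 / 40 := by
    refine le_trans (mul_le_mul_of_nonneg_left ?_ hβ0) hR
    exact hs.le_tsum (0 : Site 4) (fun z _ => abs_nonneg _)
  have hratio : β / β' ≤ 1 + 3 * (1 / 40) := charge_ratio_le hβ0 hK0 hterm hsec
  refine ⟨N₀, fun N hN => ?_⟩
  have hbox := hN₀ N hN
  have hBpos : (0 : ℝ) < #(box 4 N) := by exact_mod_cast (box_nonempty 4 N).card_pos
  have hSKle : ∑ x ∈ box 4 N, ∑ y ∈ box 4 N, K (x - y) ≤ (1 / 2 + 1 / 40) * #(box 4 N) :=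
    (div_le_iff₀ hBpos).1 hbox.2
  have hSKge : (1 / 2 - 1 / 40) * #(box 4 N) ≤ ∑ x ∈ box 4 N, ∑ y ∈ box 4 N, K (x - y) :=
    (le_div_iff₀ hBpos).1 hbox.1
  have hSK0 : 0 ≤ ∑ x ∈ box 4 N, ∑ y ∈ box 4 N, K (x - y) :=
    le_trans (mul_nonneg (by norm_num) (Nat.cast_nonneg _)) hSKge
  have hmain := boxSecondMoment_le hμ hβ0 K hs hR N
  have hstep : β / β' * ∑ x ∈ box 4 N, ∑ y ∈ box 4 N, K (x - y)
      ≤ (1 + 3 * (1 / 40)) * ((1 / 2 + 1 / 40) * #(box 4 N)) :=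
    le_trans (mul_le_mul_of_nonneg_right hratio hSK0)
      (mul_le_mul_of_nonneg_left hSKle (by norm_num))
  have hfin : ((1 + 3 * (1 / 40)) * (1 / 2 + 1 / 40) + 1 / 40 : ℝ) * #(box 4 N)
      ≤ (meanPlaq μ - 1 / 5) * #(box 4 N) :=
    mul_le_mul_of_nonneg_right (by norm_num at hmean ⊢; linarith) (le_of_lt hBpos)
  linarith [hmain, hstep, hfin]

/-- **Item `Assembly` (stmt-QuantumFields-25884).**
`WilsonU1DipoleLawD4 → WilsonU1PlaquetteSecondMomentD4 → FreeDipoleBoxMeanHalf → U1MeanPlaqToOneD4 →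
U1HelicityGapD4`: charge identification through `K(0) = 1/2` (`freeDipole_zero`), the finite-support
second-moment identity (`boxSecondMoment_eq`), the ε-budget `ε = 1/40`, `δ = 1/5`
(`u1HelicityGapD4_of_parts`). This proves only the route's implication; the node `U1HelicityGapD4`
itself stays conditional on the two open cruxes. -/
theorem assembly_proof : Summit.QuantumFields.YangMills.Theses.U1DipoleHelicity.Assembly := by
  intro hDip hSec hBox hMean
  obtain ⟨β₁, h⟩ := u1HelicityGapD4_of_parts
    (fun z : Site 4 => (1 / (2 * Real.pi) ^ 4) *
      ∫ k in Set.pi Set.univ (fun _ : Fin 4 => Set.Icc (-Real.pi) Real.pi),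
        Real.cos (∑ i : Fin 4, k i * (z i : ℝ)) *
          (((2 * Real.sin (k 0 / 2)) ^ 2 + (2 * Real.sin (k 1 / 2)) ^ 2) /
            (∑ i : Fin 4, (2 * Real.sin (k i / 2)) ^ 2)))
    freeDipole_zero hDip hSec hBox hMean
  exact ⟨β₁, fun β hβ μ hμ => ⟨1 / 5, by norm_num, h β hβ μ hμ⟩⟩

end Assembly

end Summit.QuantumFields.YangMills.Theorems.U1DipoleHelicity

end
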